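import Mathlib
import HarnessLib
import Literature.Analysis.FluidPDE.CurlFreeLiouville
import Literature.Analysis.FluidPDE.EssCurry
import Literature.Analysis.PDE.HeatLiouville
import Literature.Analysis.PDE.HeatLiouvilleHolder

/-!
# Route `UnthreadedDoor` / `ThreadingFlux`, crux `PoloidalLiouville` (stmt-NavierStokesRegularity-1222), antidynamo v2 skeleton
# (sha16 `4ebf5683127b`), rung `stub_singleDegreeRung`, EVEN degree — input (E1): HARMONIC FIELDS OF LINEAR GROWTH ARE AFFINE

Support file (seat leafhand-ns-unthreadeddoor-1 g1, cell decomp-ns), `--supports stmt-NavierStokesRegularity-1222 --as helper`; theorems only.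

The even-degree rung needs the DECOMPOSITION of a slice, `v(t, x₀ + y) = a(r)P(y)y + k(r)∇P(y) + (affine)`: the remainder
`u = v − aPy − k∇P` is curl-free and divergence-free on `ℝ³`, hence harmonic, and has (at most) linear growth; the classical Liouville
theorem then makes it AFFINE.  The tree holds Liouville for BOUNDED (`eq_of_curl_eq_zero_of_isDivFree_of_bounded`) and SUBLINEAR
(`HarmonicOnNhd.apply_eq_apply_of_sublinear`) harmonic functions; this file adds the LINEAR-GROWTH case:

* `fderiv_eq_of_laplacian_eq_zero_of_linear_growth` — a smooth `η : E → F` with `Δη = 0` and `‖η(x)‖ ≤ A(1 + ‖x‖)` has CONSTANT derivative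
  (stationary caloric lift `V(t, x) = η(x)`; the tree's scale-invariant interior gradient estimate for the heat equation
  `exists_mul_sqrt_gradSq_le_of_heat` on cylinders of size `λ → ∞` bounds `∇η` globally; each `∂ᵢη` is an entire bounded caloric function
  (`heat_dx`), hence constant by `heat_liouville`);
* `eq_add_fderiv_of_laplacian_eq_zero_of_linear_growth` — hence `η(x) = η(0) + Dη(0)[x]`;
* `affine_of_curl_eq_zero_of_isDivFree_of_linear_growth` — a smooth curl-free divergence-free field on `ℝ³` of linear growth is affine
  (tree `laplacian_eq_zero_of_curl_eq_zero_of_isDivFree`).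

HONEST LABEL: an analysis input for the open even-degree rung; nothing here proves the rung, the wall, `PoloidalLiouville` (1222), or
bears on Navier–Stokes regularity. [folklore]
-/

noncomputable section

-- the summit and its single sub-problem share the name (CONVENTIONS §1)
set_option linter.dupNamespace false

open scoped Topology InnerProductSpace RealInnerProductSpace ContDiff Laplacian
open Filter Set Function Metric MeasureTheory
open Literature.Analysis.FluidPDE Literature.Analysis.FluidPDE.Carleman

namespace Summit.NavierStokesRegularity.NavierStokesRegularity.Theorems.PoloidalLiouville.Antidynamo

section General

variable {E : Type*} [NormedAddCommGroup E] [InnerProductSpace ℝ E] [FiniteDimensional ℝ E]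
  [MeasurableSpace E] [BorelSpace E]
variable {F : Type*} [NormedAddCommGroup F] [InnerProductSpace ℝ F]

/-- **LIOUVILLE FOR HARMONIC FUNCTIONS OF LINEAR GROWTH: the derivative is constant.**  A smooth `η : E → F` on a finite-dimensional
real inner product space with `Δη ≡ 0` and `‖η(x)‖ ≤ A (1 + ‖x‖)` has `Dη(x) = Dη(x')` for all `x, x'`. [folklore] -/
theorem fderiv_eq_of_laplacian_eq_zero_of_linear_growth {η : E → F} (hη : ContDiff ℝ (⊤ : ℕ∞) η)
    (hΔ : ∀ x, (Δ η) x = 0) {A : ℝ} (hA : ∀ x, ‖η x‖ ≤ A * (1 + ‖x‖)) (x x' : E) :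
    fderiv ℝ η x = fderiv ℝ η x' := by
  set b := stdOrthonormalBasis ℝ E with hb
  -- the stationary caloric lift `V (t, y) = η y`
  set u : ℝ → E → F := fun _ => η with hu
  have hVu : (fun z : ℝ × E => η z.2) = uncurry u := rfl
  have hVs : ContDiff ℝ (⊤ : ℕ∞) (uncurry u) := by rw [← hVu]; exact hη.comp contDiff_snd
  have hV2 : ContDiffOn ℝ 2 (uncurry u) univ := (hVs.of_le (by norm_cast)).contDiffOn
  have hheat : ∀ z, dt (uncurry u) z = lap (uncurry u) z := by
    rintro ⟨t, y⟩
    have hd : DifferentiableAt ℝ (uncurry u) (t, y) := (hVs.differentiable (by simp)).differentiableAt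
    rw [dt_uncurry hd, lap_uncurry isOpen_univ (mem_univ _) hV2, Literature.Analysis.FluidPDE.timeDeriv_apply]
    simp only [hu, deriv_const, hΔ y]
  -- `A ≥ 0`
  have hA0 : 0 ≤ A := by
    have h := (norm_nonneg _).trans (hA 0)
    rw [norm_zero, add_zero, mul_one] at h
    exact h
  -- the interior gradient estimate on cylinders of size `l = 1 + ‖y‖… → ∞` (here one size suffices after rescaling the bound)
  obtain ⟨C, hC, hgrad⟩ := Literature.Analysis.PDE.exists_mul_sqrt_gradSq_le_of_heat (E := E) (F := F)
  have hgradbd : ∀ z : ℝ × E, Real.sqrt (gradSq (uncurry u) z) ≤ 2 * C * A := by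
    rintro ⟨t, y⟩
    -- for every `l ≥ 1 + ‖y‖`: `l √gradSq ≤ C A (1 + ‖y‖ + l) ≤ 2 C A l`
    have hest : ∀ l : ℝ, 1 + ‖y‖ ≤ l → Real.sqrt (gradSq (uncurry u) (t, y)) ≤ 2 * C * A := by
      intro l hl
      have hl0 : 0 < l := by have := norm_nonneg y; linarith
      have h := hgrad isOpen_univ hV2 (fun z _ => hheat z) (t₁ := t) (x₁ := y) (l := l) (B := A * (2 * l)) hl0
        (subset_univ _) ?_
      · rw [show C * (A * (2 * l)) = l * (2 * C * A) by ring] at h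
        exact le_of_mul_le_mul_left h hl0
      · rintro ⟨s, w⟩ ⟨-, hw⟩
        rw [mem_closedBall, dist_eq_norm] at hw
        have hw' : ‖w‖ ≤ ‖y‖ + l := by
          have := norm_le_norm_add_norm_sub' w y
          linarith
        calc ‖uncurry u (s, w)‖ = ‖η w‖ := rfl
          _ ≤ A * (1 + ‖w‖) := hA w
          _ ≤ A * (2 * l) := mul_le_mul_of_nonneg_left (by linarith) hA0
    exact hest (1 + ‖y‖) le_rfl
  -- each frame derivative is a bounded entire caloric function, hence constant
  have hcomp : ∀ i, dx (b i) (uncurry u) (0, x) = dx (b i) (uncurry u) (0, x') := by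
    intro i
    have hWs : ContDiff ℝ (⊤ : ℕ∞) (dx (b i) (uncurry u)) := contDiff_dx hVs _
    have hWheat : ∀ z, dt (dx (b i) (uncurry u)) z = lap (dx (b i) (uncurry u)) z :=
      fun z => Literature.Analysis.PDE.heat_dx hVs hheat (b i) z
    have hWbd : ∀ z, ‖dx (b i) (uncurry u) z‖ ≤ 2 * C * A := by
      intro z
      have h1 : ‖dx (b i) (uncurry u) z‖ ^ 2 ≤ gradSq (uncurry u) z :=
        Finset.single_le_sum (f := fun j => ‖dx (b j) (uncurry u) z‖ ^ 2) (fun j _ => sq_nonneg _)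
          (Finset.mem_univ i)
      have h2 : ‖dx (b i) (uncurry u) z‖ ≤ Real.sqrt (gradSq (uncurry u) z) := by
        have h := Real.sqrt_le_sqrt h1
        rwa [Real.sqrt_sq (norm_nonneg _)] at h
      exact h2.trans (hgradbd z)
    have key := Literature.Analysis.PDE.heat_liouville (u := dx (b i) (uncurry u)) (T := 1) (A := 2 * C * A) (γ := 0)
      le_rfl zero_lt_one ((hWs.of_le (by norm_cast)).contDiffOn) (fun z _ => hWheat z)
      (fun z _ => by rw [Real.rpow_zero, mul_one]; exact hWbd z)
      (z := ((0 : ℝ), x)) (w := ((0 : ℝ), x')) (mk_mem_prod (show (0 : ℝ) ∈ Iio 1 by norm_num) (mem_univ _))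
      (mk_mem_prod (show (0 : ℝ) ∈ Iio 1 by norm_num) (mem_univ _))
    exact key
  -- back to `η`: `dx (b i) (uncurry u) (0, y) = Dη(y) (b i)`
  have hdx : ∀ i (y : E), dx (b i) (uncurry u) (0, y) = fderiv ℝ η y (b i) := by
    intro i y
    have hd : DifferentiableAt ℝ (uncurry u) (0, y) := (hVs.differentiable (by simp)).differentiableAt
    rw [dx_uncurry hd (b i)]
  -- conclude on the orthonormal basis
  refine ContinuousLinearMap.ext fun w => ?_
  rw [← b.sum_repr w, map_sum, map_sum]
  refine Finset.sum_congr rfl fun i _ => ?_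
  rw [map_smul, map_smul, ← hdx i x, ← hdx i x', hcomp i]

/-- **Harmonic functions of linear growth are affine**: `η(x) = η(0) + Dη(0)[x]`. [folklore] -/
theorem eq_add_fderiv_of_laplacian_eq_zero_of_linear_growth {η : E → F} (hη : ContDiff ℝ (⊤ : ℕ∞) η)
    (hΔ : ∀ x, (Δ η) x = 0) {A : ℝ} (hA : ∀ x, ‖η x‖ ≤ A * (1 + ‖x‖)) (x : E) :
    η x = η 0 + fderiv ℝ η 0 x := by
  -- `φ = η − Dη(0)` has zero derivative, hence is constant
  set L : E →L[ℝ] F := fderiv ℝ η 0 with hL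
  set φ : E → F := fun y => η y - L y with hφ
  have hηd : Differentiable ℝ η := hη.differentiable (by simp)
  have hφd : Differentiable ℝ φ := hηd.sub L.differentiable
  have hφ0 : ∀ y, fderiv ℝ φ y = 0 := by
    intro y
    rw [hφ, fderiv_fun_sub (hηd y) (L.differentiableAt), L.fderiv,
      fderiv_eq_of_laplacian_eq_zero_of_linear_growth hη hΔ hA y 0, hL, sub_self]
  have hconst := is_const_of_fderiv_eq_zero hφd hφ0 x 0
  simp only [hφ, map_zero, sub_zero] at hconst
  rw [← hconst, sub_add_cancel]

end General

/-- **A smooth curl-free, divergence-free field on `ℝ³` of linear growth is affine**: `V(x) = V(0) + DV(0)[x]` (its components are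
harmonic, tree `laplacian_eq_zero_of_curl_eq_zero_of_isDivFree`, and of linear growth).  Input (E1) of the even-degree rung: the remainder
of a slice after subtracting the explicit single-degree field built from the vorticity coefficient. [folklore] -/
theorem affine_of_curl_eq_zero_of_isDivFree_of_linear_growth
    {V : EuclideanSpace ℝ (Fin 3) → EuclideanSpace ℝ (Fin 3)} (hV : ContDiff ℝ (⊤ : ℕ∞) V)
    (hcurl : ∀ x, curl V x = 0) (hdiv : VectorCalculus.IsDivFree V) {A : ℝ} (hA : ∀ x, ‖V x‖ ≤ A * (1 + ‖x‖))
    (x : EuclideanSpace ℝ (Fin 3)) : V x = V 0 + fderiv ℝ V 0 x :=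
  eq_add_fderiv_of_laplacian_eq_zero_of_linear_growth hV
    (laplacian_eq_zero_of_curl_eq_zero_of_isDivFree (hV.of_le (by norm_cast)) hcurl hdiv) hA x

end Summit.NavierStokesRegularity.NavierStokesRegularity.Theorems.PoloidalLiouville.Antidynamo

end
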